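import Mathlib.Combinatorics.SimpleGraph.Maps
import Mathlib.Data.List.Chain
import Literature.Probability.LatticeModels.LatticeGraph
import HarnessLib

/-!
# The loop-dislocated `ℤ/2`-cover of `ℤ³`

Definition request `defn-dislocationLoopCover` (routes `PercLoopDislocationCovers` /
`PercDislocationCovers` of `Summits/CriticalPhenomena/PercolationContinuityZ3`, items
`CoverIsCovering`, `CoverSlopeBound`, `CoverSubcritTransfer`).

## The object

Fix a spacing `s : ℕ` and put `t := ⌊s/2⌋`. The **dislocation patches** of `ℤ³` are the squares of
`y`-bonds (`y` = coordinate `1`)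
`{u, u + e₁}` whose lower endpoint `u` satisfies `u₁ ≡ t (mod s)`, `(u₀ - t) mod s < t` and
`u₂ mod s < t` (`IsPatchBase`); the patch through `u` is labelled by the period cell
`patchLabel s u = (⌊(u₀-t)/s⌋, (u₁-t)/s, ⌊u₂/s⌋) ∈ ℤ³`. Each patch consists of the `t × t` parallel
`y`-bonds above the sites `u₀ ∈ t + sP₀ + [0, t)`, `u₁ = t + sP₁`, `u₂ ∈ sP₂ + [0, t)` of a plane
`{y = t + ks}`; its boundary is a square *dislocation loop* of the dual lattice, and the periodic
array of these loops is an unlink `L_s ⊆ ℝ³` (spacing `≥ s - t` between distinct loops).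

The graph `dislocationLoopCover s` is the covering graph of `ℤ³` in which going once around any
single dislocation loop does NOT close up but going around twice does: the regular cover with deck
group the free product `W = ∗_{P ∈ ℤ³} ℤ/2` (one involution per loop), i.e. Biggs's covering
graph `Γ̃(K, φ)` [cite: Biggs1974, Def. 19.1] of `Γ = ℤ³` for the `K = W`-chain `φ` assigning
to a bond the generator `P` if the bond crosses patch `P` and `1` otherwise (`bondLetter`).
Concretely (as requested) the vertex type is `Site 3 × List (ℤ × ℤ × ℤ)`: an element of `W` is a
*reduced word* in the letters `ℤ³` (no two consecutive letters equal, `IsReduced`), the generator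
`P` acts on reduced words by toggling the letter `P` at the head of the word (`toggle`), and
`(u, w) ∼ (v, w')` iff `u ∼ v` in `ℤ³` and `w' = φ(u,v) · w` (`dislocationLoopCover_adj`).

## Faithfulness note (deviation from the requested inlined term)

The request inlines the adjacency as `SimpleGraph.fromRel` of
`r x y := u ∼ v ∧ y.2 = (φ?).elim x.2 (fun P => if x.2.head? = some P then x.2.tail else P :: x.2)`
on ALL lists. On non-reduced lists the head-toggle is not an involution
(`[P] ↦ []` but also `[P, P] ↦ [P]`), so after symmetrisation the vertex `(u, [P])` (`u` a patch
base with label `P`) has the two neighbours `(u + e₁, [])` and `(u + e₁, [P, P])` over the single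
base vertex `u + e₁`: that graph is not a covering of `ℤ³` at such vertices, its lifted patch cores
are infinite, and the component of `(0, [])` contains non-reduced words — contradicting the
request's own items (i), (iii) and its description of the component of the root. We therefore let
the generators act by `act P := toggle P` on reduced words and as the identity on non-reduced
words (`act`), which IS an involution on all lists (`act_involutive`). On reduced words — in
particular on the whole connected component of the root `(0, [])`, which consists exactly of the
reduced words (`reachable_root_iff`) — the adjacency is literally the requested one
(`dislocationLoopCover_adj_of_isReduced`), while the non-reduced words merely carry trivial extra
copies of `ℤ³`. With this convention `Prod.fst` is a covering map at EVERY vertex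
(`bijOn_fst_neighborSet`, the statement of item `CoverIsCovering`), for every `s`.

## API

* `dislocationLoopCover_adj` (unfolding), `dislocationLoopCover_adj_of_isReduced` (on reduced words it
  is the requested head-toggle), `dislocationLoopCover_eq_fromRel` (the requested `fromRel` shape),
  `bondLetter_comm`, `act_involutive`;
* covering: `bijOn_fst_neighborSet` (covering map in the sense of Lyons–Peres
  [cite: LyonsPeres2016, §6.9 (covering map, p. 216)], for every `s` and every vertex — the
  statement of item `CoverIsCovering`), `proj` (the projection as a graph homomorphism),
  `surjOn_fst_neighborSet` (weak covering map, the hypothesis of [cite: LyonsPeres2016, Thm. 6.47]),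
  the `LocallyFinite` instance;
* bonds off the patches keep the word (`dislocationLoopCover_adj_of_bondLetter_eq_none`), so that
  the sheets over `ℤ³ ∖ patches` are copies (request item (ii)); each patch is finite
  (`finite_patchBase_label`, request item (iii)) and patches exist for `s ≥ 2`
  (`isPatchBase_corner`, non-triviality of the cover);
* the component of the root: reducedness is constant along edges (`isReduced_iff_of_adj`), and
  for `s ≥ 2` the vertices reachable from the root `(0, [])` are EXACTLY the pairs `(u, w)` with
  `w` reduced (`reachable_root_iff`; `reachable_same_word`: sites carrying the same word are
  joined by paths avoiding the patches; `adj_patchCorner_cons`: crossing patch `P` at its corner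
  `patchCorner s P` prepends `P`) — so the component of the root is `ℤ³ × W`, the intended cover;
* automorphisms (request item (iv)): the deck transformations `deck s Q : G_s ≃g G_s`,
  `(u, w) ↦ (u, w · Q)` (end-toggle `ract`, commuting with the generators, `act_ract_comm`), and
  the lifted translations `shift hs i : G_s ≃g G_s`, `(u, w) ↦ (u + s eᵢ, w + eᵢ letterwise)` for
  `s ≠ 0` (`bondLetter_add_single`: the chain is translation-compatible).

Not here (left to the route's provers): quasi-transitivity and the exponential growth of the
component of the root (request item (v); the automorphisms `deck`, `shift` and `reachable_root_iff`
are the ingredients), and any percolation statement.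

## References

* N. Biggs, *Algebraic Graph Theory*, 2nd ed., CUP 1993 (1st ed. 1974), Ch. 19 "The covering graph
  construction", Definition 19.1 (`Γ̃(K, φ)`: vertices `K × VΓ`, `(κ₁,v₁) ∼ (κ₂,v₂)` iff
  `(v₁,v₂) ∈ SΓ` and `κ₂ = κ₁ φ(v₁,v₂)`), held copy pp. 117–118.
* R. Lyons, Y. Peres, *Probability on Trees and Networks*, CUP 2016, §6.9, p. 216: weak covering
  map / covering map; Thm. 6.47 (covering and percolation).
* I. Benjamini, O. Schramm, Percolation beyond `ℤ^d`, ECP 1 (1996), Thm. 1.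
-/

namespace Literature.Probability.Percolation

open LatticeModels

namespace DislocationLoopCover

/-! ### Words: the free product `∗_{P ∈ ℤ³} ℤ/2` on reduced words -/

/-- Toggling the letter `P` at the head of a word: remove it if it is the head, else prepend it.
This is left multiplication by the generator `P` of `∗_{P} ℤ/2` on REDUCED words. [folklore] -/
def toggle (P : ℤ × ℤ × ℤ) (w : List (ℤ × ℤ × ℤ)) : List (ℤ × ℤ × ℤ) :=
  if w.head? = some P then w.tail else P :: w

/-- A word is *reduced* if no two consecutive letters coincide (the normal forms of the free
product of copies of `ℤ/2` indexed by the letters). [folklore] -/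
def IsReduced (w : List (ℤ × ℤ × ℤ)) : Prop := w.IsChain (· ≠ ·)

/-- Reducedness is decidable. [folklore] -/
instance : DecidablePred IsReduced := fun w =>
  inferInstanceAs (Decidable (w.IsChain (· ≠ ·)))

/-- The action of the generator `P` on ALL words: `toggle P` on reduced words, the identity on
non-reduced ones (so that it is an involution everywhere, `act_involutive`). [folklore] -/
def act (P : ℤ × ℤ × ℤ) (w : List (ℤ × ℤ × ℤ)) : List (ℤ × ℤ × ℤ) :=
  if IsReduced w then toggle P w else w

variable {P Q : ℤ × ℤ × ℤ} {w : List (ℤ × ℤ × ℤ)}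

/-- `P · 1 = P`. [folklore] -/
@[simp] theorem toggle_nil (P : ℤ × ℤ × ℤ) : toggle P [] = [P] := rfl

/-- `P · (P w) = w` on words starting with `P`. [folklore] -/
@[simp] theorem toggle_cons_self (P : ℤ × ℤ × ℤ) (w : List (ℤ × ℤ × ℤ)) :
    toggle P (P :: w) = w := by
  simp [toggle]

/-- Toggling `P` prepends it to a word not starting with `P`. [folklore] -/
theorem toggle_cons_of_ne (h : Q ≠ P) (w : List (ℤ × ℤ × ℤ)) :
    toggle P (Q :: w) = P :: Q :: w := by
  simp [toggle, h]

/-- Toggling `P` prepends it to a word not starting with `P`. [folklore] -/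
theorem toggle_of_head?_ne (h : w.head? ≠ some P) : toggle P w = P :: w := by
  simp [toggle, h]

/-- The empty word is reduced. [folklore] -/
@[simp] theorem isReduced_nil : IsReduced [] := List.isChain_nil

/-- One-letter words are reduced. [folklore] -/
@[simp] theorem isReduced_singleton (P : ℤ × ℤ × ℤ) : IsReduced [P] := List.isChain_singleton P

/-- Reducedness of `P :: Q :: R`. [folklore] -/
theorem isReduced_cons_cons {R : List (ℤ × ℤ × ℤ)} :
    IsReduced (P :: Q :: R) ↔ P ≠ Q ∧ IsReduced (Q :: R) :=
  List.isChain_cons_cons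

/-- Tails of reduced words are reduced. [folklore] -/
theorem IsReduced.tail (h : IsReduced w) : IsReduced w.tail := List.IsChain.tail h

/-- Tails of reduced words are reduced. [folklore] -/
theorem IsReduced.of_cons (h : IsReduced (P :: w)) : IsReduced w := List.IsChain.tail h

/-- The head of the tail of a reduced word differs from its head. [folklore] -/
theorem IsReduced.head?_ne (h : IsReduced (P :: w)) : w.head? ≠ some P := by
  cases w with
  | nil => simp
  | cons Q R => simpa [eq_comm] using (isReduced_cons_cons.1 h).1

/-- Toggling preserves reduced words. [folklore] -/
theorem isReduced_toggle (h : IsReduced w) (P : ℤ × ℤ × ℤ) : IsReduced (toggle P w) := by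
  cases w with
  | nil => simp
  | cons Q R =>
    by_cases hQ : Q = P
    · subst hQ; simpa using h.of_cons
    · rw [toggle_cons_of_ne hQ]
      exact isReduced_cons_cons.2 ⟨Ne.symm hQ, h⟩

/-- On reduced words toggling is an involution (`P · P = 1`). [folklore] -/
theorem toggle_toggle_of_isReduced (h : IsReduced w) (P : ℤ × ℤ × ℤ) :
    toggle P (toggle P w) = w := by
  cases w with
  | nil => simp
  | cons Q R =>
    by_cases hQ : Q = P
    · subst hQ
      rw [toggle_cons_self, toggle_of_head?_ne h.head?_ne]
    · rw [toggle_cons_of_ne hQ, toggle_cons_self]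

/-- `act` is `toggle` on reduced words. [folklore] -/
theorem act_of_isReduced (h : IsReduced w) (P : ℤ × ℤ × ℤ) : act P w = toggle P w := if_pos h

/-- `act` is the identity on non-reduced words. [folklore] -/
theorem act_of_not_isReduced (h : ¬ IsReduced w) (P : ℤ × ℤ × ℤ) : act P w = w := if_neg h

/-- `act P` preserves (non-)reducedness. [folklore] -/
@[simp] theorem isReduced_act_iff : IsReduced (act P w) ↔ IsReduced w := by
  by_cases h : IsReduced w
  · rw [act_of_isReduced h]
    exact ⟨fun _ => h, fun _ => isReduced_toggle h P⟩
  · rw [act_of_not_isReduced h]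

/-- The generators act by involutions on all words. [folklore] -/
theorem act_act (P : ℤ × ℤ × ℤ) (w : List (ℤ × ℤ × ℤ)) : act P (act P w) = w := by
  by_cases h : IsReduced w
  · rw [act_of_isReduced h, act_of_isReduced (isReduced_toggle h P), toggle_toggle_of_isReduced h]
  · rw [act_of_not_isReduced h, act_of_not_isReduced h]

/-- The generators act by involutions on all words. [folklore] -/
theorem act_involutive (P : ℤ × ℤ × ℤ) : Function.Involutive (act P) := act_act P

/-- The generators act injectively. [folklore] -/
theorem act_injective (P : ℤ × ℤ × ℤ) : Function.Injective (act P) :=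
  (act_involutive P).injective

/-! ### The dislocation patches and the `W`-chain (voltage assignment) -/

/-- `u` is the lower endpoint of a `y`-bond through a dislocation patch: `u₁ ≡ ⌊s/2⌋ (mod s)`,
`(u₀ - ⌊s/2⌋) mod s < ⌊s/2⌋`, `u₂ mod s < ⌊s/2⌋` (verbatim the requested side conditions).
[folklore] -/
def IsPatchBase (s : ℕ) (u : Site 3) : Prop :=
  (s : ℤ) ∣ u 1 - (s / 2 : ℕ) ∧ (u 0 - (s / 2 : ℕ)) % (s : ℤ) < (s / 2 : ℕ) ∧ u 2 % (s : ℤ) < (s / 2 : ℕ)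

/-- Being a patch base is decidable. [folklore] -/
instance (s : ℕ) : DecidablePred (IsPatchBase s) := fun u => by
  unfold IsPatchBase; infer_instance

/-- The label (period cell) of the patch through the patch base `u`:
`(⌊(u₀ - ⌊s/2⌋)/s⌋, ⌊(u₁ - ⌊s/2⌋)/s⌋, ⌊u₂/s⌋)` (verbatim the requested letter). [folklore] -/
def patchLabel (s : ℕ) (u : Site 3) : ℤ × ℤ × ℤ :=
  ((u 0 - (s / 2 : ℕ)) / (s : ℤ), (u 1 - (s / 2 : ℕ)) / (s : ℤ), u 2 / (s : ℤ))

/-- The `W`-chain (voltage) of the ordered bond `(u, v)` of `ℤ³`: `some P` when `{u, v}` is the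
`y`-bond `{b, b + e₁}` through the patch labelled `P = patchLabel s b` (`b` its lower endpoint),
`none` (the identity of `W`) otherwise; verbatim the requested `if … else if … else none`.
[cite: Biggs1974, Def. 19.1 (K-chain φ)] -/
def bondLetter (s : ℕ) (u v : Site 3) : Option (ℤ × ℤ × ℤ) :=
  if v = u + (Pi.single 1 1 : Site 3) ∧ IsPatchBase s u then some (patchLabel s u)
  else if u = v + (Pi.single 1 1 : Site 3) ∧ IsPatchBase s v then some (patchLabel s v)
  else none

/-- No bond is `{u, u + e₁}` in both orientations at once. [folklore] -/
theorem not_eq_add_single_and (u v : Site 3) :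
    ¬ (v = u + (Pi.single 1 1 : Site 3) ∧ u = v + (Pi.single 1 1 : Site 3)) := by
  rintro ⟨hv, hu⟩
  have h := congr_fun hu 1
  rw [hv] at h
  simp only [Pi.add_apply, Pi.single_eq_same] at h
  omega

/-- The chain is symmetric: `φ(u,v) = φ(v,u)` (all voltages are involutions, so
`φ(v,u) = φ(u,v)⁻¹ = φ(u,v)`). [cite: Biggs1974, Def. 19.1 (φ(u,v) = φ(v,u)⁻¹)] -/
theorem bondLetter_comm (s : ℕ) (u v : Site 3) : bondLetter s u v = bondLetter s v u := by
  unfold bondLetter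
  by_cases h1 : v = u + (Pi.single 1 1 : Site 3) ∧ IsPatchBase s u
  · have h2 : ¬ (u = v + (Pi.single 1 1 : Site 3) ∧ IsPatchBase s v) :=
      fun h2 => not_eq_add_single_and u v ⟨h1.1, h2.1⟩
    rw [if_pos h1, if_neg h2, if_pos h1]
  · by_cases h2 : u = v + (Pi.single 1 1 : Site 3) ∧ IsPatchBase s v
    · rw [if_neg h1, if_pos h2, if_pos h2]
    · rw [if_neg h1, if_neg h2, if_neg h2, if_neg h1]

/-- Bonds not parallel to `e₁` carry no letter. [folklore] -/
theorem bondLetter_eq_none_of_ne (s : ℕ) {u v : Site 3}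
    (h1 : v ≠ u + (Pi.single 1 1 : Site 3)) (h2 : u ≠ v + (Pi.single 1 1 : Site 3)) :
    bondLetter s u v = none := by
  simp [bondLetter, h1, h2]

/-- The word update along the ordered bond `(u, v)`: apply the voltage. [cite: Biggs1974, Def. 19.1] -/
def step (s : ℕ) (u v : Site 3) (w : List (ℤ × ℤ × ℤ)) : List (ℤ × ℤ × ℤ) :=
  (bondLetter s u v).elim w (fun P => act P w)

/-- The word update does not depend on the orientation of the bond. [folklore] -/
theorem step_comm (s : ℕ) (u v : Site 3) (w : List (ℤ × ℤ × ℤ)) : step s v u w = step s u v w := by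
  rw [step, step, bondLetter_comm]

/-- Crossing a bond twice restores the word. [folklore] -/
theorem step_step (s : ℕ) (u v : Site 3) (w : List (ℤ × ℤ × ℤ)) :
    step s u v (step s u v w) = w := by
  unfold step
  cases bondLetter s u v with
  | none => rfl
  | some P => exact act_act P w

/-- The word update along a bond is injective. [folklore] -/
theorem step_injective (s : ℕ) (u v : Site 3) : Function.Injective (step s u v) :=
  Function.Involutive.injective (step_step s u v)

/-- The word update preserves (non-)reducedness. [folklore] -/
@[simp] theorem isReduced_step_iff (s : ℕ) (u v : Site 3) (w : List (ℤ × ℤ × ℤ)) :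
    IsReduced (step s u v w) ↔ IsReduced w := by
  unfold step
  cases bondLetter s u v with
  | none => rfl
  | some P => exact isReduced_act_iff

end DislocationLoopCover

open DislocationLoopCover

/-- **The loop-dislocated `ℤ/2`-cover `G_s` of `ℤ³`**: vertices `ℤ³ × (words in the letters ℤ³)`,
`(u, w) ∼ (v, w')` iff `u ∼ v` in `ℤ³` and `w'` is `w` acted on by the voltage of the bond
(`toggle P` at the head of the reduced word `w` when the bond crosses the dislocation patch `P`,
nothing otherwise). Biggs's covering graph `Γ̃(W, φ)` of `ℤ³` for the free product
`W = ∗_{ℤ³} ℤ/2` realised on reduced words; the non-reduced words carry trivial copies of `ℤ³`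
(see the module docstring, "Faithfulness note"). [cite: Biggs1974, Def. 19.1] -/
def dislocationLoopCover (s : ℕ) : SimpleGraph (Site 3 × List (ℤ × ℤ × ℤ)) where
  Adj x y := (zdGraph 3).Adj x.1 y.1 ∧ y.2 = step s x.1 y.1 x.2
  symm := ⟨fun x y h => ⟨h.1.symm, by rw [h.2, step_comm, step_step]⟩⟩
  loopless := ⟨fun _ h => h.1.ne rfl⟩

namespace DislocationLoopCover

variable {s : ℕ}

/-- Unfolding the adjacency of `G_s`. [cite: Biggs1974, Def. 19.1] -/
theorem dislocationLoopCover_adj {x y : Site 3 × List (ℤ × ℤ × ℤ)} :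
    (dislocationLoopCover s).Adj x y ↔
      (zdGraph 3).Adj x.1 y.1 ∧ y.2 = (bondLetter s x.1 y.1).elim x.2 (fun P => act P x.2) :=
  Iff.rfl

/-- On a reduced word the adjacency of `G_s` is literally the requested one: the head-toggle.
[cite: Biggs1974, Def. 19.1] -/
theorem dislocationLoopCover_adj_of_isReduced {x y : Site 3 × List (ℤ × ℤ × ℤ)}
    (hx : IsReduced x.2) :
    (dislocationLoopCover s).Adj x y ↔
      (zdGraph 3).Adj x.1 y.1 ∧ y.2 = (bondLetter s x.1 y.1).elim x.2
        (fun P => if x.2.head? = some P then x.2.tail else P :: x.2) := by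
  rw [dislocationLoopCover_adj]
  cases bondLetter s x.1 y.1 with
  | none => rfl
  | some P => simp only [Option.elim_some, act_of_isReduced hx]; rfl

/-- `G_s` in the requested `SimpleGraph.fromRel` shape (the relation is already symmetric and
irreflexive). [cite: Biggs1974, Def. 19.1 ("adjacency depends only on the unordered pair")] -/
theorem dislocationLoopCover_eq_fromRel (s : ℕ) :
    dislocationLoopCover s = SimpleGraph.fromRel fun x y : Site 3 × List (ℤ × ℤ × ℤ) =>
      (zdGraph 3).Adj x.1 y.1 ∧ y.2 = (bondLetter s x.1 y.1).elim x.2 (fun P => act P x.2) := by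
  ext x y
  rw [SimpleGraph.fromRel_adj]
  constructor
  · intro h
    exact ⟨(dislocationLoopCover s).ne_of_adj h, Or.inl h⟩
  · rintro ⟨-, h | h⟩
    · exact h
    · exact (dislocationLoopCover s).adj_symm h

/-- Bonds off the patches keep the word: over `ℤ³ ∖ patches` the cover is a product
(request item (ii)). [cite: Biggs1974, Def. 19.1 (φ = 1)] -/
theorem dislocationLoopCover_adj_of_bondLetter_eq_none {x y : Site 3 × List (ℤ × ℤ × ℤ)}
    (h : bondLetter s x.1 y.1 = none) :
    (dislocationLoopCover s).Adj x y ↔ (zdGraph 3).Adj x.1 y.1 ∧ y.2 = x.2 := by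
  rw [dislocationLoopCover_adj, h]; rfl

/-- Across a patch bond the word is acted on by the patch's generator. [cite: Biggs1974, Def. 19.1] -/
theorem dislocationLoopCover_adj_of_bondLetter_eq_some {x y : Site 3 × List (ℤ × ℤ × ℤ)}
    {P : ℤ × ℤ × ℤ} (h : bondLetter s x.1 y.1 = some P) :
    (dislocationLoopCover s).Adj x y ↔ (zdGraph 3).Adj x.1 y.1 ∧ y.2 = act P x.2 := by
  rw [dislocationLoopCover_adj, h]; rfl

/-- Reducedness of the word is constant along edges. [folklore] -/
theorem isReduced_iff_of_adj {x y : Site 3 × List (ℤ × ℤ × ℤ)}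
    (h : (dislocationLoopCover s).Adj x y) : IsReduced y.2 ↔ IsReduced x.2 := by
  rw [h.2]; exact isReduced_step_iff s x.1 y.1 x.2

/-- Reducedness of the word is constant on connected components. [folklore] -/
theorem isReduced_iff_of_reachable {x y : Site 3 × List (ℤ × ℤ × ℤ)}
    (h : (dislocationLoopCover s).Reachable x y) : IsReduced y.2 ↔ IsReduced x.2 := by
  obtain ⟨p⟩ := h
  induction p with
  | nil => rfl
  | cons hadj _ ih => rw [ih, isReduced_iff_of_adj hadj]

/-- The connected component of the root `õ = (0, [])` consists of reduced words. [folklore] -/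
theorem isReduced_of_reachable_root {x : Site 3 × List (ℤ × ℤ × ℤ)}
    (h : (dislocationLoopCover s).Reachable ((0 : Site 3), ([] : List (ℤ × ℤ × ℤ))) x) :
    IsReduced x.2 :=
  (isReduced_iff_of_reachable h).2 isReduced_nil

/-! ### `Prod.fst` is a covering map -/

/-- The covering projection `G_s → ℤ³` as a graph homomorphism. [cite: Biggs1974, Def. 19.1]
[cite: LyonsPeres2016, §6.9 (covering map, p. 216)] -/
def proj (s : ℕ) : dislocationLoopCover s →g zdGraph 3 where
  toFun := Prod.fst
  map_rel' h := h.1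

/-- `proj` is `Prod.fst`. [folklore] -/
@[simp] theorem proj_apply (x : Site 3 × List (ℤ × ℤ × ℤ)) : proj s x = x.1 := rfl

/-- The unique lift at `x` of the base neighbour `v` of `x.1`. [cite: Biggs1974, Def. 19.1] -/
def lift (s : ℕ) (x : Site 3 × List (ℤ × ℤ × ℤ)) (v : Site 3) : Site 3 × List (ℤ × ℤ × ℤ) :=
  (v, step s x.1 v x.2)

/-- The lift of a base edge is an edge. [cite: Biggs1974, Def. 19.1] -/
theorem adj_lift {x : Site 3 × List (ℤ × ℤ × ℤ)} {v : Site 3} (h : (zdGraph 3).Adj x.1 v) :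
    (dislocationLoopCover s).Adj x (lift s x v) :=
  ⟨h, rfl⟩

/-- Every neighbour of `x` is the lift at `x` of its projection (unique path lifting, one step). [cite: Biggs1974, Def. 19.1] -/
theorem eq_lift_of_adj {x y : Site 3 × List (ℤ × ℤ × ℤ)} (h : (dislocationLoopCover s).Adj x y) :
    y = lift s x y.1 :=
  Prod.ext rfl h.2

/-- `Prod.fst` maps neighbours to neighbours (it is a graph homomorphism). [cite: LyonsPeres2016, §6.9 (covering map, p. 216)] -/
theorem mapsTo_fst_neighborSet (s : ℕ) (x : Site 3 × List (ℤ × ℤ × ℤ)) :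
    Set.MapsTo Prod.fst ((dislocationLoopCover s).neighborSet x) ((zdGraph 3).neighborSet x.1) :=
  fun _ h => h.1

/-- `Prod.fst` is injective on the neighbours of every vertex. [cite: LyonsPeres2016, §6.9 (covering map, p. 216)] -/
theorem injOn_fst_neighborSet (s : ℕ) (x : Site 3 × List (ℤ × ℤ × ℤ)) :
    Set.InjOn Prod.fst ((dislocationLoopCover s).neighborSet x) := by
  intro y hy z hz hyz
  rw [eq_lift_of_adj hy, eq_lift_of_adj hz]
  exact congrArg (lift s x) hyz

/-- `Prod.fst` is a weak covering map (the hypothesis of the covering inequality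
`θ_{ℤ³}(u) ≤ θ_{G_s}(u, w)`). [cite: LyonsPeres2016, Thm. 6.47 (weak covering map)] -/
theorem surjOn_fst_neighborSet (s : ℕ) (x : Site 3 × List (ℤ × ℤ × ℤ)) :
    Set.SurjOn Prod.fst ((dislocationLoopCover s).neighborSet x) ((zdGraph 3).neighborSet x.1) :=
  fun v hv => ⟨lift s x v, adj_lift hv, rfl⟩

/-- **`G_s → ℤ³` is a covering map** at every vertex and for every `s`: `Prod.fst` maps the
neighbours of `x` bijectively onto the neighbours of `x.1` (the statement of route item
`CoverIsCovering`). [cite: LyonsPeres2016, §6.9 (covering map, p. 216)] [cite: Biggs1974, Def. 19.1] -/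
theorem bijOn_fst_neighborSet (s : ℕ) (x : Site 3 × List (ℤ × ℤ × ℤ)) :
    Set.BijOn Prod.fst ((dislocationLoopCover s).neighborSet x) ((zdGraph 3).neighborSet x.1) :=
  ⟨mapsTo_fst_neighborSet s x, injOn_fst_neighborSet s x, surjOn_fst_neighborSet s x⟩

/-- `G_s` is locally finite (`6`-regular), the neighbours of `x` being the lifts of the `6`
neighbours of `x.1`. [folklore] -/
theorem finite_neighborSet (s : ℕ) (x : Site 3 × List (ℤ × ℤ × ℤ)) :
    ((dislocationLoopCover s).neighborSet x).Finite :=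
  Set.Finite.of_finite_image
    (((zdGraph 3).neighborFinset x.1).finite_toSet.subset (by
      rintro _ ⟨y, hy, rfl⟩
      exact Finset.mem_coe.2 ((SimpleGraph.mem_neighborFinset _ _ _).2 hy.1)))
    (injOn_fst_neighborSet s x)

/-- `G_s` is locally finite. [folklore] -/
noncomputable instance (s : ℕ) : (dislocationLoopCover s).LocallyFinite := fun x =>
  (finite_neighborSet s x).fintype

/-! ### Deck transformations: the letters acting at the END of the word -/

section Deck

variable {P Q : ℤ × ℤ × ℤ} {w : List (ℤ × ℤ × ℤ)}

/-- Toggling at the head of a nonempty word. [folklore] -/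
theorem toggle_cons (P R : ℤ × ℤ × ℤ) (X : List (ℤ × ℤ × ℤ)) :
    toggle P (R :: X) = if R = P then X else P :: R :: X := by
  by_cases h : R = P
  · subst h; simp
  · rw [toggle_cons_of_ne h, if_neg h]

/-- Toggling the letter `Q` at the END of a word (right multiplication by the generator `Q` on
reduced words), defined through `List.reverse`. [folklore] -/
def rtoggle (Q : ℤ × ℤ × ℤ) (w : List (ℤ × ℤ × ℤ)) : List (ℤ × ℤ × ℤ) :=
  (toggle Q w.reverse).reverse

/-- Reversal preserves reducedness. [folklore] -/
theorem isReduced_reverse : IsReduced w.reverse ↔ IsReduced w := by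
  unfold IsReduced
  rw [List.isChain_reverse]
  exact ⟨fun h => h.imp fun _ _ h => Ne.symm h, fun h => h.imp fun _ _ h => Ne.symm h⟩

/-- End-toggling, explicitly: remove the last letter if it is `Q`, else append `Q`. [folklore] -/
theorem rtoggle_eq (Q : ℤ × ℤ × ℤ) (w : List (ℤ × ℤ × ℤ)) :
    rtoggle Q w = if w.getLast? = some Q then w.dropLast else w ++ [Q] := by
  unfold rtoggle toggle
  rw [List.head?_reverse]
  split_ifs
  · rw [List.tail_reverse, List.reverse_reverse]
  · rw [List.reverse_cons, List.reverse_reverse]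

/-- `1 · Q = Q`. [folklore] -/
@[simp] theorem rtoggle_nil (Q : ℤ × ℤ × ℤ) : rtoggle Q [] = [Q] := rfl

/-- End-toggling a one-letter word. [folklore] -/
theorem rtoggle_singleton (Q R : ℤ × ℤ × ℤ) :
    rtoggle Q [R] = if R = Q then [] else [R, Q] := by
  rw [rtoggle_eq]
  by_cases h : R = Q
  · subst h; simp
  · simp [h]

/-- End-toggling does not touch the head of a word of length `≥ 2`. [folklore] -/
theorem rtoggle_cons_cons (Q R R' : ℤ × ℤ × ℤ) (t : List (ℤ × ℤ × ℤ)) :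
    rtoggle Q (R :: R' :: t) = R :: rtoggle Q (R' :: t) := by
  rw [rtoggle_eq, rtoggle_eq, List.getLast?_cons_cons, List.dropLast_cons_cons, List.cons_append]
  split_ifs <;> rfl

/-- End-toggling preserves reduced words. [folklore] -/
theorem isReduced_rtoggle (h : IsReduced w) (Q : ℤ × ℤ × ℤ) : IsReduced (rtoggle Q w) := by
  rw [rtoggle, isReduced_reverse]
  exact isReduced_toggle (isReduced_reverse.2 h) Q

/-- On reduced words end-toggling is an involution (`Q · Q = 1`). [folklore] -/
theorem rtoggle_rtoggle_of_isReduced (h : IsReduced w) (Q : ℤ × ℤ × ℤ) :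
    rtoggle Q (rtoggle Q w) = w := by
  rw [rtoggle, rtoggle, List.reverse_reverse, toggle_toggle_of_isReduced (isReduced_reverse.2 h),
    List.reverse_reverse]

/-- Head-toggles and end-toggles commute (left and right multiplication in `W` commute; checked
directly on all lists, including the words of length `≤ 1` where both touch the same letter).
[folklore] -/
theorem toggle_rtoggle_comm (P Q : ℤ × ℤ × ℤ) (w : List (ℤ × ℤ × ℤ)) :
    toggle P (rtoggle Q w) = rtoggle Q (toggle P w) := by
  cases w with
  | nil =>
    rw [rtoggle_nil, toggle_nil, toggle_cons, rtoggle_singleton]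
    by_cases h : Q = P
    · subst h; simp
    · rw [if_neg h, if_neg (Ne.symm h)]
  | cons R m =>
    cases m with
    | nil =>
      rw [rtoggle_singleton, toggle_cons]
      by_cases hRQ : R = Q
      · subst hRQ
        by_cases hRP : R = P
        · subst hRP; simp
        · rw [if_pos rfl, if_neg hRP, toggle_nil, rtoggle_cons_cons, rtoggle_singleton, if_pos rfl]
      · by_cases hRP : R = P
        · subst hRP
          rw [if_neg hRQ, if_pos rfl, toggle_cons, if_pos rfl, rtoggle_nil]
        · rw [if_neg hRQ, if_neg hRP, toggle_cons, if_neg hRP, rtoggle_cons_cons, rtoggle_singleton,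
            if_neg hRQ]
    | cons R' t =>
      rw [rtoggle_cons_cons, toggle_cons, toggle_cons]
      by_cases hRP : R = P
      · rw [if_pos hRP, if_pos hRP]
      · rw [if_neg hRP, if_neg hRP, rtoggle_cons_cons, rtoggle_cons_cons]

/-- The right action of the generator `Q` on ALL words: `rtoggle Q` on reduced words, the
identity on non-reduced ones. [folklore] -/
def ract (Q : ℤ × ℤ × ℤ) (w : List (ℤ × ℤ × ℤ)) : List (ℤ × ℤ × ℤ) :=
  if IsReduced w then rtoggle Q w else w

/-- `ract` is `rtoggle` on reduced words. [folklore] -/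
theorem ract_of_isReduced (h : IsReduced w) (Q : ℤ × ℤ × ℤ) : ract Q w = rtoggle Q w := if_pos h

/-- `ract` is the identity on non-reduced words. [folklore] -/
theorem ract_of_not_isReduced (h : ¬ IsReduced w) (Q : ℤ × ℤ × ℤ) : ract Q w = w := if_neg h

/-- `ract Q` preserves (non-)reducedness. [folklore] -/
@[simp] theorem isReduced_ract_iff : IsReduced (ract Q w) ↔ IsReduced w := by
  by_cases h : IsReduced w
  · rw [ract_of_isReduced h]
    exact ⟨fun _ => h, fun _ => isReduced_rtoggle h Q⟩
  · rw [ract_of_not_isReduced h]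

/-- The right action is by involutions on all words. [folklore] -/
theorem ract_ract (Q : ℤ × ℤ × ℤ) (w : List (ℤ × ℤ × ℤ)) : ract Q (ract Q w) = w := by
  by_cases h : IsReduced w
  · rw [ract_of_isReduced h, ract_of_isReduced (isReduced_rtoggle h Q),
      rtoggle_rtoggle_of_isReduced h]
  · rw [ract_of_not_isReduced h, ract_of_not_isReduced h]

/-- The right action is by involutions on all words. [folklore] -/
theorem ract_involutive (Q : ℤ × ℤ × ℤ) : Function.Involutive (ract Q) := ract_ract Q

/-- The left (voltage) action and the right (deck) action commute. [folklore] -/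
theorem act_ract_comm (P Q : ℤ × ℤ × ℤ) (w : List (ℤ × ℤ × ℤ)) :
    act P (ract Q w) = ract Q (act P w) := by
  by_cases h : IsReduced w
  · rw [ract_of_isReduced h, act_of_isReduced (isReduced_rtoggle h Q), act_of_isReduced h,
      ract_of_isReduced (isReduced_toggle h P), toggle_rtoggle_comm]
  · rw [ract_of_not_isReduced h, act_of_not_isReduced h, ract_of_not_isReduced h]

/-- The word update along a bond commutes with the right action. [folklore] -/
theorem step_ract (s : ℕ) (u v : Site 3) (Q : ℤ × ℤ × ℤ) (w : List (ℤ × ℤ × ℤ)) :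
    step s u v (ract Q w) = ract Q (step s u v w) := by
  unfold step
  cases bondLetter s u v with
  | none => rfl
  | some P => exact act_ract_comm P Q w

/-- The right action of a letter as a permutation of all words. [folklore] -/
def ractPerm (Q : ℤ × ℤ × ℤ) : Equiv.Perm (List (ℤ × ℤ × ℤ)) :=
  Function.Involutive.toPerm (ract Q) (ract_involutive Q)

/-- `ractPerm Q` is `ract Q`. [folklore] -/
@[simp] theorem ractPerm_apply (Q : ℤ × ℤ × ℤ) (w : List (ℤ × ℤ × ℤ)) : ractPerm Q w = ract Q w :=
  rfl

/-- **Deck transformations.** Right multiplication of the word by a letter `Q` is an automorphism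
of `G_s` preserving every fibre of `Prod.fst` (request item (iv), letter part); these generate the
deck group `W`, which acts simply transitively on the reduced words over each base vertex.
[cite: Biggs1974, Prop. 19.3 (K acts on Γ̃(K, φ) by automorphisms)] -/
def deck (s : ℕ) (Q : ℤ × ℤ × ℤ) : dislocationLoopCover s ≃g dislocationLoopCover s where
  toEquiv := (Equiv.refl (Site 3)).prodCongr (ractPerm Q)
  map_rel_iff' {x y} := by
    obtain ⟨u, w⟩ := x
    obtain ⟨v, w'⟩ := y
    show (dislocationLoopCover s).Adj (u, ract Q w) (v, ract Q w') ↔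
      (dislocationLoopCover s).Adj (u, w) (v, w')
    simp only [dislocationLoopCover, step_ract]
    exact and_congr_right fun _ => (ract_involutive Q).injective.eq_iff

/-- The deck transformation of the letter `Q`, explicitly. [cite: Biggs1974, Prop. 19.3] -/
@[simp] theorem deck_apply (s : ℕ) (Q : ℤ × ℤ × ℤ) (x : Site 3 × List (ℤ × ℤ × ℤ)) :
    deck s Q x = (x.1, ract Q x.2) := rfl

/-- Deck transformations preserve the fibres of the projection. [cite: Biggs1974, Prop. 19.3] -/
theorem fst_deck (s : ℕ) (Q : ℤ × ℤ × ℤ) (x : Site 3 × List (ℤ × ℤ × ℤ)) :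
    (deck s Q x).1 = x.1 := rfl

end Deck

/-! ### Lifted translations by the period `s` -/

/-- The unit vectors of the letter lattice `ℤ³ = ℤ × ℤ × ℤ`. [folklore] -/
def letterUnit (i : Fin 3) : ℤ × ℤ × ℤ :=
  ((Pi.single i 1 : Fin 3 → ℤ) 0, (Pi.single i 1 : Fin 3 → ℤ) 1, (Pi.single i 1 : Fin 3 → ℤ) 2)

/-- Relabelling the letters of a word by an injective map commutes with toggling. [folklore] -/
theorem toggle_map {f : ℤ × ℤ × ℤ → ℤ × ℤ × ℤ} (hf : Function.Injective f) (P : ℤ × ℤ × ℤ)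
    (w : List (ℤ × ℤ × ℤ)) : toggle (f P) (w.map f) = (toggle P w).map f := by
  cases w with
  | nil => rfl
  | cons R t =>
    rw [List.map_cons, toggle_cons, toggle_cons]
    by_cases h : R = P
    · rw [if_pos (congrArg f h), if_pos h]
    · rw [if_neg (hf.ne h), if_neg h, List.map_cons, List.map_cons]

/-- Injective relabelling preserves reducedness. [folklore] -/
theorem isReduced_map_iff {f : ℤ × ℤ × ℤ → ℤ × ℤ × ℤ} (hf : Function.Injective f)
    {w : List (ℤ × ℤ × ℤ)} : IsReduced (w.map f) ↔ IsReduced w := by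
  unfold IsReduced
  rw [List.isChain_map]
  simp only [hf.ne_iff]

/-- Injective relabelling commutes with the action of the generators. [folklore] -/
theorem act_map {f : ℤ × ℤ × ℤ → ℤ × ℤ × ℤ} (hf : Function.Injective f) (P : ℤ × ℤ × ℤ)
    (w : List (ℤ × ℤ × ℤ)) : act (f P) (w.map f) = (act P w).map f := by
  by_cases h : IsReduced w
  · rw [act_of_isReduced ((isReduced_map_iff hf).2 h), act_of_isReduced h, toggle_map hf]
  · rw [act_of_not_isReduced (mt (isReduced_map_iff hf).1 h), act_of_not_isReduced h]

/-- The patch predicate is `s`-periodic in every coordinate direction. [folklore] -/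
theorem isPatchBase_add_single_iff (i : Fin 3) (u : Site 3) :
    IsPatchBase s (u + Pi.single i (s : ℤ)) ↔ IsPatchBase s u := by
  have h0 : ∀ x : ℤ, (x + s - (s / 2 : ℕ)) % (s : ℤ) = (x - (s / 2 : ℕ)) % (s : ℤ) := fun x => by
    rw [add_sub_right_comm, Int.add_emod_right]
  have h1 : ∀ x : ℤ, (s : ℤ) ∣ x + s - (s / 2 : ℕ) ↔ (s : ℤ) ∣ x - (s / 2 : ℕ) := fun x => by
    rw [add_sub_right_comm, dvd_add_self_right]
  have h2 : ∀ x : ℤ, (x + s) % (s : ℤ) = x % (s : ℤ) := fun x => Int.add_emod_right x s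
  unfold IsPatchBase
  simp only [Pi.add_apply, Pi.single_apply]
  split_ifs <;> simp only [add_zero, h0, h1, h2]

section Shift

variable (hs : s ≠ 0)
include hs

/-- Translating a patch base by `s eᵢ` moves its label by the unit vector `eᵢ`. [folklore] -/
theorem patchLabel_add_single (i : Fin 3) (u : Site 3) :
    patchLabel s (u + Pi.single i (s : ℤ)) = patchLabel s u + letterUnit i := by
  have hs' : (s : ℤ) ≠ 0 := Int.natCast_ne_zero.2 hs
  have hd2 : ∀ x : ℤ, (x + s) / s = x / s + 1 := fun x => by
    simpa using Int.add_mul_ediv_right x 1 hs'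
  have hd1 : ∀ x : ℤ, (x + s - (s / 2 : ℕ)) / s = (x - (s / 2 : ℕ)) / s + 1 := fun x => by
    rw [add_sub_right_comm, hd2]
  unfold patchLabel letterUnit
  simp only [Pi.add_apply, Pi.single_apply, Prod.mk_add_mk]
  split_ifs <;> simp only [add_zero, hd1, hd2]

/-- The chain is equivariant under the lifted translations: translating a bond by `s eᵢ` relabels
its letter by `eᵢ`. [cite: Biggs1974, Def. 19.2 (compatible K-chain)] -/
theorem bondLetter_add_single (i : Fin 3) (u v : Site 3) :
    bondLetter s (u + Pi.single i (s : ℤ)) (v + Pi.single i (s : ℤ)) =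
      (bondLetter s u v).map (· + letterUnit i) := by
  unfold bondLetter
  simp only [isPatchBase_add_single_iff, patchLabel_add_single hs,
    add_right_comm _ (Pi.single i (s : ℤ)) (Pi.single 1 1 : Site 3), add_left_inj]
  split_ifs <;> rfl

/-- The word update is equivariant under the lifted translations. [cite: Biggs1974, Def. 19.2 (compatible K-chain)] -/
theorem step_add_single (i : Fin 3) (u v : Site 3) (w : List (ℤ × ℤ × ℤ)) :
    step s (u + Pi.single i (s : ℤ)) (v + Pi.single i (s : ℤ)) (w.map (· + letterUnit i)) =
      (step s u v w).map (· + letterUnit i) := by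
  unfold step
  rw [bondLetter_add_single hs]
  cases bondLetter s u v with
  | none => rfl
  | some P => exact act_map (add_left_injective (letterUnit i)) P w

/-- **Lifted translations.** `(u, w) ↦ (u + s eᵢ, w relabelled by P ↦ P + eᵢ)` is an automorphism
of `G_s` covering the translation by `s eᵢ` of `ℤ³` (request item (iv), translation part; with
the deck transformations this gives the quasi-transitivity of the component of the root).
[cite: Biggs1974, Prop. 19.3] -/
def shift (i : Fin 3) : dislocationLoopCover s ≃g dislocationLoopCover s where
  toEquiv := (Equiv.addRight (Pi.single i (s : ℤ) : Site 3)).prodCongr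
    (Equiv.listEquivOfEquiv (Equiv.addRight (letterUnit i)))
  map_rel_iff' {x y} := by
    obtain ⟨u, w⟩ := x
    obtain ⟨v, w'⟩ := y
    show (dislocationLoopCover s).Adj (u + Pi.single i (s : ℤ), w.map (· + letterUnit i))
        (v + Pi.single i (s : ℤ), w'.map (· + letterUnit i)) ↔
      (dislocationLoopCover s).Adj (u, w) (v, w')
    simp only [dislocationLoopCover, step_add_single hs]
    refine and_congr ?_ (List.map_injective_iff.2 (add_left_injective (letterUnit i))).eq_iff
    exact zdGraph_adj_shift_iff (Pi.single i (s : ℤ)) u v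

/-- The lifted translation, explicitly. [cite: Biggs1974, Prop. 19.3] -/
theorem shift_apply (i : Fin 3) (x : Site 3 × List (ℤ × ℤ × ℤ)) :
    shift hs i x = (x.1 + Pi.single i (s : ℤ), x.2.map (· + letterUnit i)) := rfl

/-- The lifted translation covers the translation by `s eᵢ` of `ℤ³`. [cite: Biggs1974, Prop. 19.3] -/
theorem fst_shift (i : Fin 3) (x : Site 3 × List (ℤ × ℤ × ℤ)) :
    (shift hs i x).1 = x.1 + Pi.single i (s : ℤ) := rfl

/-! ### The patches are finite -/

/-- Each dislocation patch is finite: the patch bases with a given label form a finite set (of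
`⌊s/2⌋²` sites; request item (iii): every lifted patch core is finite). [folklore] -/
theorem finite_patchBase_label (P : ℤ × ℤ × ℤ) :
    {u : Site 3 | IsPatchBase s u ∧ patchLabel s u = P}.Finite := by
  have hs' : (s : ℤ) ≠ 0 := Int.natCast_ne_zero.2 hs
  have hpos : (0 : ℤ) < s := by positivity
  refine Set.Finite.of_finite_image (f := fun u : Site 3 => ((u 0 - (s / 2 : ℕ)) % (s : ℤ), u 2 % (s : ℤ)))
    (((Set.finite_Ico (0 : ℤ) s).prod (Set.finite_Ico (0 : ℤ) s)).subset ?_) ?_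
  · rintro _ ⟨u, -, rfl⟩
    exact ⟨⟨Int.emod_nonneg _ hs', Int.emod_lt_of_pos _ hpos⟩,
      ⟨Int.emod_nonneg _ hs', Int.emod_lt_of_pos _ hpos⟩⟩
  · rintro u ⟨hu, rfl⟩ u' ⟨hu', hP⟩ hf
    simp only [Prod.mk.injEq] at hf
    simp only [patchLabel, Prod.mk.injEq] at hP
    obtain ⟨h0, h1, h2⟩ := hP
    have e0 := Int.emod_add_mul_ediv (u 0 - (s / 2 : ℕ)) s
    have e0' := Int.emod_add_mul_ediv (u' 0 - (s / 2 : ℕ)) s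
    have e1 := Int.mul_ediv_cancel' hu.1
    have e1' := Int.mul_ediv_cancel' hu'.1
    have e2 := Int.emod_add_mul_ediv (u 2) s
    have e2' := Int.emod_add_mul_ediv (u' 2) s
    rw [h0, ← hf.1] at e0'
    rw [h1] at e1'
    rw [h2, ← hf.2] at e2'
    funext j
    fin_cases j
    · simp only [Fin.zero_eta]; omega
    · simp only [Fin.mk_one]; omega
    · simp only [Fin.reduceFinMk]; omega

end Shift

/-- A patch base and the bond above it carry the patch's letter. [cite: Biggs1974, Def. 19.1] -/
theorem bondLetter_of_isPatchBase {u : Site 3} (h : IsPatchBase s u) :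
    bondLetter s u (u + Pi.single 1 1) = some (patchLabel s u) :=
  if_pos ⟨rfl, h⟩

/-- Non-vacuity: for `s ≥ 2` the corner `(⌊s/2⌋, ⌊s/2⌋, 0)` of the period cell is a patch base
(so `G_s` is not the trivial cover). [folklore] -/
theorem isPatchBase_corner (hs : 2 ≤ s) :
    IsPatchBase s (fun i => if i = 2 then 0 else ((s / 2 : ℕ) : ℤ)) := by
  have h2 : (0 : ℤ) < ((s / 2 : ℕ) : ℤ) := by
    have : 0 < s / 2 := Nat.div_pos hs two_pos
    exact_mod_cast this
  refine ⟨?_, ?_, ?_⟩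
  · show (s : ℤ) ∣ (if (1 : Fin 3) = 2 then 0 else ((s / 2 : ℕ) : ℤ)) - (s / 2 : ℕ)
    rw [if_neg (by decide), sub_self]
    exact dvd_zero _
  · show ((if (0 : Fin 3) = 2 then 0 else ((s / 2 : ℕ) : ℤ)) - (s / 2 : ℕ)) % (s : ℤ) < (s / 2 : ℕ)
    rw [if_neg (by decide), sub_self, Int.zero_emod]
    exact h2
  · show (if (2 : Fin 3) = 2 then 0 else ((s / 2 : ℕ) : ℤ)) % (s : ℤ) < (s / 2 : ℕ)
    rw [if_pos rfl, Int.zero_emod]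
    exact h2

/-! ### The component of the root: exactly the reduced words (`s ≥ 2`) -/

section Component

/-- An edge of `ℤ³` whose bond carries no letter lifts to word-preserving edges. [cite: Biggs1974, Def. 19.1] -/
theorem adj_same_word {u v : Site 3} (huv : (zdGraph 3).Adj u v) (h : bondLetter s u v = none)
    (w : List (ℤ × ℤ × ℤ)) : (dislocationLoopCover s).Adj (u, w) (v, w) :=
  (dislocationLoopCover_adj_of_bondLetter_eq_none (x := (u, w)) (y := (v, w)) h).2 ⟨huv, rfl⟩

/-- Bonds between sites of equal `y`-coordinate carry no letter. [folklore] -/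
theorem bondLetter_eq_none_of_apply_one_eq {u v : Site 3} (h : v 1 = u 1) :
    bondLetter s u v = none := by
  refine bondLetter_eq_none_of_ne s ?_ ?_
  · intro hv
    have h' := congr_fun hv 1
    simp only [Pi.add_apply, Pi.single_eq_same] at h'
    omega
  · intro hu
    have h' := congr_fun hu 1
    simp only [Pi.add_apply, Pi.single_eq_same] at h'
    omega

/-- Moving in a coordinate direction other than `y` never changes the word. [folklore] -/
theorem reachable_add_single_of_ne_one {i : Fin 3} (hi : i ≠ 1) (u : Site 3)
    (w : List (ℤ × ℤ × ℤ)) (k : ℤ) :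
    (dislocationLoopCover s).Reachable (u, w) (u + Pi.single i k, w) := by
  have hcoord : ∀ c : ℤ, (u + Pi.single i c : Site 3) 1 = u 1 := fun c => by
    simp only [Pi.add_apply, Pi.single_eq_of_ne (Ne.symm hi), add_zero]
  induction k using Int.induction_on with
  | zero => simp
  | succ n ih =>
    refine ih.trans (SimpleGraph.Adj.reachable (adj_same_word ?_ ?_ w))
    · rw [zdGraph_adj_iff]
      exact ⟨i, Or.inl (by rw [add_assoc, ← Pi.single_add])⟩
    · exact bondLetter_eq_none_of_apply_one_eq (by rw [hcoord, hcoord])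
  | pred n ih =>
    refine ih.trans (SimpleGraph.Adj.reachable (adj_same_word ?_ ?_ w))
    · rw [zdGraph_adj_iff]
      refine ⟨i, Or.inr ?_⟩
      rw [add_assoc, ← Pi.single_add]
      congr 2
      ring
    · exact bondLetter_eq_none_of_apply_one_eq (by rw [hcoord, hcoord])

/-- A `y`-bond whose lower endpoint has its `x`-residue outside the patch window carries no
letter. [folklore] -/
theorem bondLetter_eq_none_of_not_lt {u v : Site 3} (hv : v = u + Pi.single 1 1)
    (hu : ¬ (u 0 - (s / 2 : ℕ)) % (s : ℤ) < (s / 2 : ℕ)) : bondLetter s u v = none := by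
  have h1 : ¬ (v = u + (Pi.single 1 1 : Site 3) ∧ IsPatchBase s u) := fun h => hu h.2.2.1
  have h2 : ¬ (u = v + (Pi.single 1 1 : Site 3) ∧ IsPatchBase s v) :=
    fun h => not_eq_add_single_and u v ⟨hv, h.1⟩
  simp only [bondLetter, if_neg h1, if_neg h2]

/-- In a column whose `x`-residue is outside the patch window, moving in the `y`-direction never
changes the word. [folklore] -/
theorem reachable_add_single_one {u : Site 3} (hu : ¬ (u 0 - (s / 2 : ℕ)) % (s : ℤ) < (s / 2 : ℕ))
    (w : List (ℤ × ℤ × ℤ)) (k : ℤ) :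
    (dislocationLoopCover s).Reachable (u, w) (u + Pi.single 1 k, w) := by
  have h01 : (0 : Fin 3) ≠ 1 := by decide
  have hcol : ∀ c : ℤ, ¬ ((u + Pi.single 1 c : Site 3) 0 - (s / 2 : ℕ)) % (s : ℤ) < (s / 2 : ℕ) :=
      fun c => by
    simp only [Pi.add_apply, Pi.single_eq_of_ne h01, add_zero]
    exact hu
  induction k using Int.induction_on with
  | zero => simp
  | succ n ih =>
    refine ih.trans (SimpleGraph.Adj.reachable (adj_same_word ?_ ?_ w))
    · rw [zdGraph_adj_iff]
      exact ⟨1, Or.inl (by rw [add_assoc, ← Pi.single_add])⟩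
    · exact bondLetter_eq_none_of_not_lt (by rw [add_assoc, ← Pi.single_add]) (hcol n)
  | pred n ih =>
    have e : u + Pi.single 1 (-(n : ℤ)) = u + Pi.single 1 (-(n : ℤ) - 1) + Pi.single 1 1 := by
      rw [add_assoc, ← Pi.single_add]
      congr 2
      ring
    refine ih.trans (SimpleGraph.Adj.reachable (adj_same_word ?_ ?_ w))
    · rw [zdGraph_adj_iff]
      exact ⟨1, Or.inr e⟩
    · rw [bondLetter_comm]
      exact bondLetter_eq_none_of_not_lt e (hcol _)

/-- **Word-preserving connectivity** (`s ≥ 2`): any two sites carrying the same word are joined in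
`G_s` by a path avoiding the patches (detour through a column of `x`-residue `s - 1`, where no
`y`-bond is a patch bond). [folklore] -/
theorem reachable_same_word (hs : 2 ≤ s) (u v : Site 3) (w : List (ℤ × ℤ × ℤ)) :
    (dislocationLoopCover s).Reachable (u, w) (v, w) := by
  have hs0 : (0 : ℤ) < s := by exact_mod_cast (show 0 < s by omega)
  have hts : ((s / 2 : ℕ) : ℤ) ≤ (s : ℤ) - 1 := by
    have : s / 2 < s := Nat.div_lt_self (by omega) one_lt_two
    omega
  -- the detour column
  set a : ℤ := (s : ℤ) - 1 - (u 0 - (s / 2 : ℕ)) % (s : ℤ) with ha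
  have hcol : ¬ ((u + Pi.single 0 a : Site 3) 0 - (s / 2 : ℕ)) % (s : ℤ) < (s / 2 : ℕ) := by
    simp only [Pi.add_apply, Pi.single_eq_same]
    have e := Int.emod_add_mul_ediv (u 0 - (s / 2 : ℕ)) s
    have e' : u 0 + a - (s / 2 : ℕ) = (s - 1) + s * ((u 0 - (s / 2 : ℕ)) / s) := by omega
    rw [e', Int.add_mul_emod_self_left, Int.emod_eq_of_lt (by omega) (by omega)]
    omega
  have h1 := reachable_add_single_of_ne_one (s := s) (i := 0) (by decide) u w a
  have h2 := reachable_add_single_one hcol w (v 1 - u 1)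
  have h3 := reachable_add_single_of_ne_one (s := s) (i := 0) (by decide)
    (u + Pi.single 0 a + Pi.single 1 (v 1 - u 1)) w (v 0 - u 0 - a)
  have h4 := reachable_add_single_of_ne_one (s := s) (i := 2) (by decide)
    (u + Pi.single 0 a + Pi.single 1 (v 1 - u 1) + Pi.single 0 (v 0 - u 0 - a)) w (v 2 - u 2)
  have hv : u + Pi.single 0 a + Pi.single 1 (v 1 - u 1) + Pi.single 0 (v 0 - u 0 - a) +
      Pi.single 2 (v 2 - u 2) = v := by
    have h01 : (0 : Fin 3) ≠ 1 := by decide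
    have h02 : (0 : Fin 3) ≠ 2 := by decide
    have h12 : (1 : Fin 3) ≠ 2 := by decide
    funext j
    fin_cases j
    · simp only [Fin.zero_eta, Pi.add_apply, Pi.single_eq_same, Pi.single_eq_of_ne h01,
        Pi.single_eq_of_ne h02]
      ring
    · simp only [Fin.mk_one, Pi.add_apply, Pi.single_eq_same, Pi.single_eq_of_ne (Ne.symm h01),
        Pi.single_eq_of_ne h12]
      ring
    · simp only [Fin.reduceFinMk, Pi.add_apply, Pi.single_eq_same, Pi.single_eq_of_ne (Ne.symm h02),
        Pi.single_eq_of_ne (Ne.symm h12)]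
      ring
  rw [← hv]
  exact h1.trans (h2.trans (h3.trans h4))

/-- The lower-left patch base of the patch labelled `P`:
`(⌊s/2⌋ + s P₀, ⌊s/2⌋ + s P₁, s P₂)`. [folklore] -/
def patchCorner (s : ℕ) (P : ℤ × ℤ × ℤ) : Site 3 :=
  fun i => if i = 0 then ((s / 2 : ℕ) : ℤ) + s * P.1
    else if i = 1 then ((s / 2 : ℕ) : ℤ) + s * P.2.1 else (s : ℤ) * P.2.2

/-- The `x`-coordinate of the patch corner. [folklore] -/
theorem patchCorner_apply_zero (s : ℕ) (P : ℤ × ℤ × ℤ) :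
    patchCorner s P 0 = ((s / 2 : ℕ) : ℤ) + s * P.1 := by
  show (if (0 : Fin 3) = 0 then _ else _) = _
  rw [if_pos rfl]

/-- The `y`-coordinate of the patch corner. [folklore] -/
theorem patchCorner_apply_one (s : ℕ) (P : ℤ × ℤ × ℤ) :
    patchCorner s P 1 = ((s / 2 : ℕ) : ℤ) + s * P.2.1 := by
  show (if (1 : Fin 3) = 0 then _ else if (1 : Fin 3) = 1 then _ else _) = _
  rw [if_neg (by decide), if_pos rfl]

/-- The `z`-coordinate of the patch corner. [folklore] -/
theorem patchCorner_apply_two (s : ℕ) (P : ℤ × ℤ × ℤ) : patchCorner s P 2 = (s : ℤ) * P.2.2 := by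
  show (if (2 : Fin 3) = 0 then _ else if (2 : Fin 3) = 1 then _ else _) = _
  rw [if_neg (by decide), if_neg (by decide)]

/-- For `s ≥ 2` the patch corner is a patch base (every patch is nonempty). [folklore] -/
theorem isPatchBase_patchCorner (hs : 2 ≤ s) (P : ℤ × ℤ × ℤ) : IsPatchBase s (patchCorner s P) := by
  have ht : (0 : ℤ) < ((s / 2 : ℕ) : ℤ) := by exact_mod_cast Nat.div_pos hs two_pos
  unfold IsPatchBase
  rw [patchCorner_apply_zero, patchCorner_apply_one, patchCorner_apply_two, add_sub_cancel_left,
    add_sub_cancel_left, Int.mul_emod_right, Int.mul_emod_right]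
  exact ⟨dvd_mul_right _ _, ht, ht⟩

/-- The patch corner of `P` is labelled `P`. [folklore] -/
theorem patchLabel_patchCorner (hs : s ≠ 0) (P : ℤ × ℤ × ℤ) : patchLabel s (patchCorner s P) = P := by
  have hs' : (s : ℤ) ≠ 0 := Int.natCast_ne_zero.2 hs
  unfold patchLabel
  rw [patchCorner_apply_zero, patchCorner_apply_one, patchCorner_apply_two, add_sub_cancel_left,
    add_sub_cancel_left, Int.mul_ediv_cancel_left _ hs', Int.mul_ediv_cancel_left _ hs',
    Int.mul_ediv_cancel_left _ hs']

/-- Crossing the patch `P` at its corner from the word `w'` (not starting with `P`) yields `P :: w'`.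
[cite: Biggs1974, Def. 19.1] -/
theorem adj_patchCorner_cons (hs : 2 ≤ s) {P : ℤ × ℤ × ℤ} {w' : List (ℤ × ℤ × ℤ)}
    (hw : IsReduced (P :: w')) :
    (dislocationLoopCover s).Adj (patchCorner s P, w')
      (patchCorner s P + Pi.single 1 1, P :: w') := by
  refine ⟨(zdGraph_adj_iff _ _).2 ⟨1, Or.inl rfl⟩, ?_⟩
  show P :: w' = step s (patchCorner s P) (patchCorner s P + Pi.single 1 1) w'
  rw [step, bondLetter_of_isPatchBase (isPatchBase_patchCorner hs P),
    patchLabel_patchCorner (by omega) P, Option.elim_some, act_of_isReduced hw.of_cons,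
    toggle_of_head?_ne hw.head?_ne]

/-- **Every reduced word is reached from the root** (`s ≥ 2`): build the word from its last letter
backwards, crossing patch `P` at its corner to prepend `P` and moving freely in between.
[folklore] -/
theorem reachable_root_of_isReduced (hs : 2 ≤ s) {w : List (ℤ × ℤ × ℤ)} (hw : IsReduced w)
    (u : Site 3) :
    (dislocationLoopCover s).Reachable ((0 : Site 3), ([] : List (ℤ × ℤ × ℤ))) (u, w) := by
  induction w generalizing u with
  | nil => exact reachable_same_word hs 0 u []
  | cons P w' ih =>
    exact (ih hw.of_cons (patchCorner s P)).trans
      ((adj_patchCorner_cons hs hw).reachable.trans (reachable_same_word hs _ u _))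

/-- **The component of the root** `õ = (0, [])` of `G_s` (`s ≥ 2`) is exactly `ℤ³ × {reduced words}`,
i.e. `ℤ³ × W`: the cover with deck group `W = ∗_{ℤ³} ℤ/2` acting simply transitively on fibres.
[cite: Biggs1974, Def. 19.1] -/
theorem reachable_root_iff (hs : 2 ≤ s) {x : Site 3 × List (ℤ × ℤ × ℤ)} :
    (dislocationLoopCover s).Reachable ((0 : Site 3), ([] : List (ℤ × ℤ × ℤ))) x ↔ IsReduced x.2 :=
  ⟨isReduced_of_reachable_root, fun h => reachable_root_of_isReduced hs h x.1⟩

end Component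

end DislocationLoopCover

end Literature.Probability.Percolation
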